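import Literature.AnabelianGeometry.AbsoluteAnabelian.MonoidKummerMapsProp32iPresentationIndep
import Literature.AnabelianGeometry.AbsoluteAnabelian.AbsTopIII.ReconstructionCor110NatResidueRestriction
import Literature.AnabelianGeometry.AbsoluteAnabelian.GaloisCyclotomeRestrictionCompatHolds
import HarnessLib

/-!
# [AbsTopIII] Prop. 3.2 (i), Rmk. 3.2.2: the index clause «dividing by the index» TRANSFERRED to the `h2Iso` of
# the Kummer theory of record

S. Mochizuki, *Topics in Absolute Anabelian Geometry III*, Rmk. 3.2.2 p. 73 l. 21–28 («the functoriality of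
Proposition 3.2, (i), when applied to the isomorphism `H²(G, μ_Ẑ(M_TM)) ⥲ Ẑ`, is to be understood in the sense of a
"compatibility", relative to dividing the "`Ẑ`" … by a factor given by the index of the image of the induced open
homomorphism on arithmetic Galois groups»), Rmk. 1.10.1 (iii) p. 44; kurims render `url-5493eb38cbb7`.
abc-iut cell, layer L4, sub-DAG [AbsTopIII] Prop. 3.2 (i) row P32.i.L07, follow-on «P32i-INDEX-TRANSFER» to L4-lead
RULING #8d (5) (residual X1 of (i) = the open-injection/index clause, shared with Cor. 1.10 (i)).
abc-iut-L4-d3's `Cor110Nat.residue_galCyclotomeRes_of_compatible` (`ReconstructionCor110NatResidueRestriction.lean`,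
p436994) proves the index formula for the residue chain `cohomologyLimitMuEquivZHat ∘ continuousCohomologyTwoTateModuleEquiv
∘ H²(galCyclotomeIsoTateModule)` along the FIELD restriction `G_{k′} ⊆ G_k` (abc-iut-w5-d201's `galCyclotomeRes`),
MODULO the restriction-compatibility `hres` of the two coefficient identifications (= abc-iut-L4-t11's «S4c»;
unconditional for the INDUCED identification).  Since the `h2Iso` of abc-iut-L4-t2's Kummer theory OF RECORD
(`kummerTheoryStd`, `MLFClosure.galH2EquivZhat`) IS that chain (`kummerTheoryStd_h2Iso_iso_eq_residueIso`, rfl,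
`MonoidKummerMapsProp32iPresentationIndep.lean`), the clause transfers VERBATIM:
* `galH2EquivZhat_galCyclotomeRes_of_compatible` / `_induced` — for `(MLFClosure.std k).galH2EquivZhat`;
* **`kummerTheoryStd_h2Iso_galCyclotomeRes_of_compatible` / `_induced`** — for model presentations `π`, `π′` with
  fields `k ⊆ k′`: `h2Iso_{π′}(H²(i_{φ′}) (Res x)) = [k′ : k] • h2Iso_π(H²(i_φ) x)` in `Ẑ`.
So Prop. 3.2 (i)'s residual at print strength is DECL-FOR-DECL Cor. 1.10 (i)'s: the hypothesis `hres` for THE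
characterised data (abc-iut-L4-t11 «S4c») — nothing else (iso case / presentation independence: p438943, p440649).
HONEST FRAMING: proof-only transfer of landed theorems (classical LCFT); the general morphism of `𝒞^MLF_TM` (injective
OPEN homomorphism `G ↪ G*`, Def. 3.1 (ii)) = (abstract isomorphism onto the image) ∘ (field restriction), the first
factor being `kummerTheoryStd_h2Iso_chart_independent`; nothing here bears on [IUTchIII] Cor. 3.12; no side taken;
model-presented ≠ node-level.

## References
* [MochizukiAbsTopIII2015] S. Mochizuki, *Topics in Absolute Anabelian Geometry III*, Prop. 3.2 (i) p. 71,
  Rmk. 3.2.2 p. 73, Rmk. 1.10.1 (iii) p. 44.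
-/

noncomputable section

open CategoryTheory Function
open Field ValuativeRel
open ProfiniteGrp ProfiniteGrp.ProfiniteCompletion

namespace Literature.AnabelianGeometry.AbsoluteAnabelian

open _root_.TopRep _root_.ContRepresentation _root_.ContinuousCohomology
open Literature.NumberTheory.GaloisRepresentations
open Literature.NumberTheory.GaloisRepresentations.DiscreteGaloisModule
open Literature.AnabelianGeometry.EtaleTheta Literature.AnabelianGeometry.EtaleTheta.ZHatLevel

section Index

variable {k k' : Type} [Field k] [ValuativeRel k] [TopologicalSpace k] [IsNonarchimedeanLocalField k]
  [CharZero k] [Field k'] [ValuativeRel k'] [TopologicalSpace k'] [IsNonarchimedeanLocalField k']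
  [CharZero k'] [Algebra k k'] [FiniteDimensional k k']
  (φ : muQZ (absoluteGaloisGroup k) ≃+ Additive (CommGroup.torsion (AlgebraicClosure k)ˣ))
  (hφ : ∀ (σ : absoluteGaloisGroup k) (x : muQZ (absoluteGaloisGroup k)),
    (((Additive.toMul (φ (σ • x)) : CommGroup.torsion (AlgebraicClosure k)ˣ) :
        (AlgebraicClosure k)ˣ) : AlgebraicClosure k) =
      σ • (((Additive.toMul (φ x) : CommGroup.torsion (AlgebraicClosure k)ˣ) :
        (AlgebraicClosure k)ˣ) : AlgebraicClosure k))
  (φ' : muQZ (absoluteGaloisGroup k') ≃+ Additive (CommGroup.torsion (AlgebraicClosure k')ˣ))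
  (hφ' : ∀ (σ : absoluteGaloisGroup k') (x : muQZ (absoluteGaloisGroup k')),
    (((Additive.toMul (φ' (σ • x)) : CommGroup.torsion (AlgebraicClosure k')ˣ) :
        (AlgebraicClosure k')ˣ) : AlgebraicClosure k') =
      σ • (((Additive.toMul (φ' x) : CommGroup.torsion (AlgebraicClosure k')ˣ) :
        (AlgebraicClosure k')ˣ) : AlgebraicClosure k'))

/-- **Rmk. 3.2.2 for the `h2Iso` of record along a field restriction, modulo restriction-compatible
identifications**: for `x ∈ H²(G_k, μ_Ẑ(G_k))`, abc-iut-L4-t2's `galH2EquivZhat` at `k′` of `H²(i_{φ′})(Res x)` is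
`[k′ : k]` times `galH2EquivZhat` at `k` of `H²(i_φ) x`, whenever `φ′` is the identification induced from `φ`
(hypothesis `hres`, abc-iut-L4-t11's «S4c» for THE characterised data).  Transfer of abc-iut-L4-d3's
`Cor110Nat.residue_galCyclotomeRes_of_compatible`. [cite: MochizukiAbsTopIII2015, Remark 3.2.2 p.73] -/
theorem galH2EquivZhat_galCyclotomeRes_of_compatible
    (hres : ∀ x : muQZ (absoluteGaloisGroup k'), φ' x = inducedCyclotomeEquiv k k' φ x)
    (x : galCyclotomeH2 (absoluteGaloisGroup k)) :
    ((MLFClosure.std k').galH2EquivZhat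
        ((cohomologyMap (galCyclotomeIsoTateModule k' φ' hφ').hom 2).hom ((galCyclotomeRes k k' 2).hom x))).down =
      Module.finrank k k' •
        ((MLFClosure.std k).galH2EquivZhat ((cohomologyMap (galCyclotomeIsoTateModule k φ hφ).hom 2).hom x)).down :=
  Cor110Nat.residue_galCyclotomeRes_of_compatible φ hφ φ' hφ' hres x

/-- **Unconditional instance**: with `φ′ :=` the identification INDUCED from `φ` (abc-iut-w5-d201's
`inducedCyclotomeEquiv`), `galH2EquivZhat_{k′}(H²(i_{φ′})(Res x)) = [k′ : k] • galH2EquivZhat_k(H²(i_φ) x)`.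
[cite: MochizukiAbsTopIII2015, Remark 3.2.2 p.73] -/
theorem galH2EquivZhat_galCyclotomeRes_induced (x : galCyclotomeH2 (absoluteGaloisGroup k)) :
    ((MLFClosure.std k').galH2EquivZhat
        ((cohomologyMap (galCyclotomeIsoTateModule k' (inducedCyclotomeEquiv k k' φ)
          (inducedCyclotomeEquiv_smul k k' φ hφ)).hom 2).hom ((galCyclotomeRes k k' 2).hom x))).down =
      Module.finrank k k' •
        ((MLFClosure.std k).galH2EquivZhat ((cohomologyMap (galCyclotomeIsoTateModule k φ hφ).hom 2).hom x)).down :=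
  galH2EquivZhat_galCyclotomeRes_of_compatible φ hφ _ _ (fun _ => rfl) x

end Index

/-! ### The same for model presentations of abstract pairs -/

section Presentations

variable {P P' : GaloisMonoidPair.{0}} (π : P.ModelPresentation) (π' : P'.ModelPresentation)
  (R : TorsionReciprocityData π.C.k) (R' : TorsionReciprocityData π'.C.k)
  [Algebra π.C.k π'.C.k] [FiniteDimensional π.C.k π'.C.k]
  (φ : muQZ (absoluteGaloisGroup π.C.k) ≃+ Additive (CommGroup.torsion (AlgebraicClosure π.C.k)ˣ))
  (hφ : ∀ (σ : absoluteGaloisGroup π.C.k) (x : muQZ (absoluteGaloisGroup π.C.k)),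
    (((Additive.toMul (φ (σ • x)) : CommGroup.torsion (AlgebraicClosure π.C.k)ˣ) :
        (AlgebraicClosure π.C.k)ˣ) : AlgebraicClosure π.C.k) =
      σ • (((Additive.toMul (φ x) : CommGroup.torsion (AlgebraicClosure π.C.k)ˣ) :
        (AlgebraicClosure π.C.k)ˣ) : AlgebraicClosure π.C.k))
  (φ' : muQZ (absoluteGaloisGroup π'.C.k) ≃+ Additive (CommGroup.torsion (AlgebraicClosure π'.C.k)ˣ))
  (hφ' : ∀ (σ : absoluteGaloisGroup π'.C.k) (x : muQZ (absoluteGaloisGroup π'.C.k)),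
    (((Additive.toMul (φ' (σ • x)) : CommGroup.torsion (AlgebraicClosure π'.C.k)ˣ) :
        (AlgebraicClosure π'.C.k)ˣ) : AlgebraicClosure π'.C.k) =
      σ • (((Additive.toMul (φ' x) : CommGroup.torsion (AlgebraicClosure π'.C.k)ˣ) :
        (AlgebraicClosure π'.C.k)ˣ) : AlgebraicClosure π'.C.k))

/-- **Rmk. 3.2.2 for the Kummer theories of record of two presented abstract pairs whose fields form a finite
extension `k ⊆ k′`** (the field-restriction leg of a morphism of `𝒞^MLF_TM`), modulo restriction-compatible
identifications: `h2Iso_{π′}(H²(i_{φ′})(Res x)) = [k′ : k] • h2Iso_π(H²(i_φ) x)`.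
[cite: MochizukiAbsTopIII2015, Remark 3.2.2 p.73] -/
theorem kummerTheoryStd_h2Iso_galCyclotomeRes_of_compatible
    (hres : ∀ x : muQZ (absoluteGaloisGroup π'.C.k), φ' x = inducedCyclotomeEquiv π.C.k π'.C.k φ x)
    (x : galCyclotomeH2 (absoluteGaloisGroup π.C.k)) :
    ((π'.kummerTheoryStd R').h2Iso
        ((cohomologyMap (galCyclotomeIsoTateModule π'.C.k φ' hφ').hom 2).hom
          ((galCyclotomeRes π.C.k π'.C.k 2).hom x))).down =
      Module.finrank π.C.k π'.C.k •
        ((π.kummerTheoryStd R).h2Iso ((cohomologyMap (galCyclotomeIsoTateModule π.C.k φ hφ).hom 2).hom x)).down :=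
  galH2EquivZhat_galCyclotomeRes_of_compatible φ hφ φ' hφ' hres x

/-- Unconditional instance with the INDUCED identification at `k′`. [cite: MochizukiAbsTopIII2015, Remark 3.2.2 p.73] -/
theorem kummerTheoryStd_h2Iso_galCyclotomeRes_induced (x : galCyclotomeH2 (absoluteGaloisGroup π.C.k)) :
    ((π'.kummerTheoryStd R').h2Iso
        ((cohomologyMap (galCyclotomeIsoTateModule π'.C.k (inducedCyclotomeEquiv π.C.k π'.C.k φ)
          (inducedCyclotomeEquiv_smul π.C.k π'.C.k φ hφ)).hom 2).hom
          ((galCyclotomeRes π.C.k π'.C.k 2).hom x))).down =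
      Module.finrank π.C.k π'.C.k •
        ((π.kummerTheoryStd R).h2Iso ((cohomologyMap (galCyclotomeIsoTateModule π.C.k φ hφ).hom 2).hom x)).down :=
  galH2EquivZhat_galCyclotomeRes_induced φ hφ x

end Presentations

/-! ### Unconditional: THE characterised data (abc-iut-L4-t11's restriction-compatibility, file F) -/

section Datum

variable {k k' : Type} [Field k] [ValuativeRel k] [TopologicalSpace k] [IsNonarchimedeanLocalField k]
  [CharZero k] [Field k'] [ValuativeRel k'] [TopologicalSpace k'] [IsNonarchimedeanLocalField k']
  [CharZero k'] [Algebra k k'] [FiniteDimensional k k']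

variable (k k') in
/-- **Rmk. 3.2.2 along a field restriction for THE characterised identifications, unconditional**: with
`φ_k := D_k.equiv`, `φ_{k′} := D_{k′}.equiv`, `D_• = (exists_torsionReciprocityData_levelChar •).choose` (THE data of
[AbsTopIII] Cor. 1.10 (i), abc-iut-L4-d3 / `Cor110iaNat.datum`), `galH2EquivZhat_{k′}(H²(i_{φ_{k′}})(Res x)) =
[k′ : k] • galH2EquivZhat_k(H²(i_{φ_k}) x)` — the hypothesis `hres` of `galH2EquivZhat_galCyclotomeRes_of_compatible`
discharged by abc-iut-L4-t11's `Cor110Open.levelChar_equiv_eq_inducedCyclotomeEquiv` ([AbsAnab] Prop. 1.2.1 (vi)).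
[cite: MochizukiAbsTopIII2015, Remark 3.2.2 p.73] -/
theorem galH2EquivZhat_galCyclotomeRes_datum (x : galCyclotomeH2 (absoluteGaloisGroup k)) :
    ((MLFClosure.std k').galH2EquivZhat
        ((cohomologyMap (galCyclotomeIsoTateModule k' (exists_torsionReciprocityData_levelChar k').choose.equiv
          (exists_torsionReciprocityData_levelChar k').choose.equiv_smul).hom 2).hom
          ((galCyclotomeRes k k' 2).hom x))).down =
      Module.finrank k k' •
        ((MLFClosure.std k).galH2EquivZhat ((cohomologyMap (galCyclotomeIsoTateModule k
          (exists_torsionReciprocityData_levelChar k).choose.equiv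
          (exists_torsionReciprocityData_levelChar k).choose.equiv_smul).hom 2).hom x)).down :=
  galH2EquivZhat_galCyclotomeRes_of_compatible _ _ _ _
    (Cor110Open.levelChar_equiv_eq_inducedCyclotomeEquiv k k') x

end Datum

section PresentationsDatum

variable {P P' : GaloisMonoidPair.{0}} (π : P.ModelPresentation) (π' : P'.ModelPresentation)
  (R : TorsionReciprocityData π.C.k) (R' : TorsionReciprocityData π'.C.k)
  [Algebra π.C.k π'.C.k] [FiniteDimensional π.C.k π'.C.k]

/-- **Rmk. 3.2.2 for the Kummer theories of record of two presented abstract pairs along the field restriction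
`k ⊆ k′`, at THE characterised identifications — unconditional** (the «Prop. 3.2 (i) twin» of the
Cor. 1.10 (i) appends; hypothesis `hres` of `kummerTheoryStd_h2Iso_galCyclotomeRes_of_compatible` discharged by
abc-iut-L4-t11's `Cor110Open.levelChar_equiv_eq_inducedCyclotomeEquiv`):
`h2Iso_{π′}(H²(i_{φ_{k′}})(Res x)) = [k′ : k] • h2Iso_π(H²(i_{φ_k}) x)`. [cite: MochizukiAbsTopIII2015, Remark 3.2.2 p.73] -/
theorem kummerTheoryStd_h2Iso_galCyclotomeRes_datum (x : galCyclotomeH2 (absoluteGaloisGroup π.C.k)) :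
    ((π'.kummerTheoryStd R').h2Iso
        ((cohomologyMap (galCyclotomeIsoTateModule π'.C.k
          (exists_torsionReciprocityData_levelChar π'.C.k).choose.equiv
          (exists_torsionReciprocityData_levelChar π'.C.k).choose.equiv_smul).hom 2).hom
          ((galCyclotomeRes π.C.k π'.C.k 2).hom x))).down =
      Module.finrank π.C.k π'.C.k •
        ((π.kummerTheoryStd R).h2Iso ((cohomologyMap (galCyclotomeIsoTateModule π.C.k
          (exists_torsionReciprocityData_levelChar π.C.k).choose.equiv
          (exists_torsionReciprocityData_levelChar π.C.k).choose.equiv_smul).hom 2).hom x)).down :=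
  kummerTheoryStd_h2Iso_galCyclotomeRes_of_compatible π π' R R' _ _ _ _
    (Cor110Open.levelChar_equiv_eq_inducedCyclotomeEquiv π.C.k π'.C.k) x

end PresentationsDatum

end Literature.AnabelianGeometry.AbsoluteAnabelian

end
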